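import Summits.CriticalPhenomena.PercolationContinuityZ3.Theorems.Transplant.SkelPhiFaceKitsOfNums9
import HarnessLib

/-!
# N1 ({±1} node), (F) column, part F-H6 (hp-8 g35): **`FaceOblRM` OF THE FINE-CELL SCHEME FROM THE KIT INPUTS AND THE PER-CENTRE NUMBERS —
# the keystone v6 COMPOSED with `faceOblRM_fineNb2`** (`Skelφ.faceOblRM_of_kits6`): `faceOblRM_fineNb2` (p301391) with its `hkits` binder
# DISCHARGED by `hkits_faceSteps_of_nums6` (p316174), i.e. ONE statement whose hypotheses are exactly (scheme-side slot facts of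
# `faceOblRM_fineNb2`) ∪ (kit / route / Λ / numbers binders of the keystone v6), tuple-free.  This is layer (a0) of the (F) wrapper: the wrapper
# `faceHoldsRNOFnL_negChoiceAllOTA` instantiates it at stmt's (ζ′) tuple (`pr := prFA`, `P := fcellsA`, `φ := φL`, `w₀ := t`,
# `(gap, gap', E₀, L') := (Prm.gap S, 0, Prm.E₀ S, Prm.Lp S)`, `off := offNA`, `b₀ := b0TA`, `δc := κ.δ`, `δ₂ := κ.δ₂`, `δ := δkit`,
# `hchain := hchain_of_chainFactL …`) and discharges the kit block as `SkelPhiRootNegBXTA` does for the root.  Name hygiene: the keystone's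
# chain budget is `nB` here (the keystone calls it `nF`, shadowing its per-axis count `nF : Fin 2 → ℕ`, here `nFc`); the kit-level excess
# radius/bound are `R₁k/ηk` (the scheme-level ones of `faceOblRM_fineNb2` keep `R₁/η`).
builds on p205010 (kernel theorem, internal audit signed; external expert review pending) — nothing in this file uses p205010; no claim about the open node.
Lane `prim-bschramm`, seat `prim-hp-8` (gen 35); helper file (`--supports stmt-CriticalPhenomena-4575 --as helper`).
* **`Skelφ.faceOblRM_of_kits6`**.
[cite: KozmaNitzan2024, §4 Lemma 10 (pp. 17–21), Lemma 12 (pp. 23–25), p. 30 (Step III)] [cite: MartineauTassion2017, §4.3 Lemma 4.2]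
v7 note: v7 (hp-8 g36, 2026-08-22): the box-width binders carry the level floor `j₀ ≤ j` (D1: `KS.levels_wide` needs it; the old `∀ j ≤ j₁` form was unservable for thin bridge boxes) and the kit-excess hypothesis reads a GENERIC planar diameter `m` of the step region and a GENERIC entrance depth `ρZ` of the zone (D2: the old `box 2 (2·r)`/`Rs` reading was circular in `r`).
v8 note: v8 (hp-8 g36, 2026-08-22 07:55Z): the numbers binders `numsX/numsY` and the caps `hnFx/hnFy` receive the realised-radius facts `L′ ≤ Λ.rM a′ (x + stepVec du)` and `r ≤ Λ.rE a′ x du` held at the call site (they fail at the root-adjacent face `a′ = 0, x + stepVec du = 0`, so a provider cannot know them for every `x`).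
v9 note: v9 (hp-8 g36, 2026-08-22 09:15Z): the y′-face numbers and kit rooms read their OWN half-widths `qB′ qB₃′` (level-units landing half-width, α-units x-run start half-width) — v8 shared `qB qB₃` with the x-face (α-units landing, level-units y′-run start `≥ W ≈ n_Lℓ_L/U`), a units mismatch that breaks the y′-face floors FT5/FT6/FL1/FL2 when `ℓ_L ≫ Kq·n_L`.
-/

noncomputable section

open MeasureTheory ProbabilityTheory
open scoped ENNReal Classical

namespace Summit.CriticalPhenomena.PercolationContinuityZ3.Theorems.Transplant

namespace Skelφ

open Literature.Probability.Percolation Literature.Probability.LatticeModels SimpleGraph GadgetSystem Contour KNCells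
open Literature.Probability.Percolation.KozmaNitzan
open Literature.Probability.Percolation.KozmaNitzan.Cells (oth oth_ne sgOf sgOf_sign stepVec_apply_fst eq_oth_of_ne oth_oth)
open KNLevels ChainPlanar ChainPara
open Literature.Barriers.CriticalPhenomena (graphBall mem_graphBall_self graphBall_mono)
open BoxProdZ2 (ConcRadiiG Erad Frad nQ nS Realised Frad_succ Frad_le_Erad)
open Skel (winGraph routeW excess WinStepData)
open SkelI (tanOff)
open TwoAxis.Para (modulus detD rep₂)

variable {V : Type} [DecidableEq V] [Countable V] {G : SimpleGraph V} [G.LocallyFinite] {φ : V → Site 2}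

/-- **`FaceOblRM` of the fine-cell scheme of record from the kit inputs and the per-centre numbers** (keystone v6 ∘ `faceOblRM_fineNb2`;
see the module docstring). [cite: KozmaNitzan2024, §4 Lemma 10 (pp. 17–21), Lemma 12 (pp. 23–25), p. 30] -/
theorem faceOblRM_of_kits9 (pr : FinePrm) (φ : V → Site 2) (P : PCells2) (w₀ : V) (gap gap' : ℕ → ℕ) (E₀ L' : ℕ) (off : Site 2 → ℕ)
    (b₀ : Fin 2 → ℕ) (q : unitInterval) (δc : ℝ)
    -- the binders of `faceOblRM_fineNb2` (scheme side)
    (hlip : Lip G φ) (hstep : Steps G φ) (hb₀ : ∀ i, b₀ i ≤ 3 * P.r i) (hb1 : ∀ i, 1 ≤ b₀ i) (hc₀ : 0 < pr.c₀)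
    (hc₁ : 0 < pr.c₁)
    (hDd : pr.D = detD pr.A pr.n pr.h pr.vα pr.vβ) (hD : 0 < pr.D) (hL0 : pr.c₀ * pr.L 0 + 2 ≤ pr.D) (hL1 : pr.c₁ * pr.L 1 + 2 ≤ pr.D)
    (hgap : ∀ n, 1 ≤ gap n) (hgap20 : ∀ n, 20 * P.rmax ≤ gap n) {c : ℕ} (hgapc : ∀ n, c ≤ gap n) (hE₀ : 2 ≤ E₀) (hL' : 1 ≤ L')
    (hoff : ∀ x : Site 2, off x ≤ c * ((x 0).natAbs + (x 1).natAbs) + 1)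
    (hoffN : ∀ x : Site 2, (rep₂ pr.A pr.n pr.h pr.vα pr.vβ pr.c₀ pr.c₁ (P.cen x) 0).natAbs +
      (rep₂ pr.A pr.n pr.h pr.vα pr.vβ pr.c₀ pr.c₁ (P.cen x) 1).natAbs + 1 ≤ off x)
    {Δ' : ℕ} (Rlev N M : ℕ) {δ₂ : ℝ} (hRlev : ∀ i, Rlev + 4 ≤ 10 * P.s i) (hRlev' : ∀ i, Rlev + 4 ≤ 3 * P.r i)
    (aw : MDir → ℕ) {k₀ : ℤ} {kF : Fin 2 → ℤ} (hk₀ : ∀ I, pr.rdN I (pr.bOf I) ≤ pr.rdK I (pr.bOf I) * k₀)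
    (hk₀' : ∀ i, 3 * (P.r i : ℤ) + k₀ + 3 ≤ 5 * P.r i)
    (hroomF : ∀ du : MDir,
      pr.Mabs * (aw du + Rlev + 1) + pr.rdN du.1 (pr.bOf du.1) * (Rlev + 2) * pr.D ≤ pr.rdK du.1 (pr.bOf du.1) * kF du.1 * pr.D)
    (hkF : ∀ I, kF I + 3 ≤ 5 * (P.r (oth I) : ℤ))
    (haw : ∀ du : MDir, (pr.rdK 1 (pr.bOf du.1) * (P.faceExt du 0 + 1) + pr.rdK 0 (pr.bOf du.1) * (P.faceExt du 1 + 1)) * pr.D ≤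
      pr.Mabs * (aw du + 1))
    (hcount : 1 / (1 - (q : ℝ)) ^ (Δ' * N) ≤ δ₂ * ((Finset.Icc (M + 1) Rlev).card : ℝ))
    {η : ℝ} (hη : η ≤ δc / 2) (R₁ : ℕ → ℕ) {m : ℕ}
    (hR₁ : ∀ ρ R', R₁ ρ ≤ R' → ∀ (Rw : ℕ) (D' A' : Finset V), (∀ d ∈ D', d ∈ graphBall G w₀ Rw) →
      (∀ d ∈ D', ∀ d' ∈ D', φ d - φ d' ∈ box 2 m) → A' ⊆ D' → (∀ a ∈ A', a ∈ graphBall G w₀ (ρ + 1)) →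
        (bondPercolation G q).real (excess G w₀ R' D' A') ≤ η)
    (hdiam : ∀ b' : Fin 2, (pr.rdK 1 b' + pr.rdK 0 b') * ((50 * P.rmax : ℕ) + 1) * pr.D ≤ pr.Mabs * (m + 1))
    (hgapR : ∀ ρ, c + 2 * L' + R₁ ρ + 2 ≤ gap ρ)
    -- the binders of the keystone `hkits_faceSteps_of_nums6` (kit / route / Λ / numbers)
    {types : Finset V} (hfr : Frames G φ types) (hκ : CylConn G φ types)
    {Δg : ℕ} (hΔg : ∀ v, G.degree v ≤ Δg)
    (hA0 : 0 < pr.A) {nL : ℕ} (hnL : 1 ≤ nL) (hvL : |pr.vα| ≤ nL)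
    (hmf : 0 ≤ modulus nL pr.h pr.vα pr.vβ)
    {nFc : Fin 2 → ℕ} (hnC : ∀ I, (nFc I : ℤ) ≤ pr.cOf I * |pr.A| * |pr.lvGen I (pr.bOf I)|)
    (hU3 : ∀ I, pr.D ≤ 3 * (nFc I : ℤ)) {E r : ℕ} (hδ₂ : 0 < δ₂)
    -- THE ROUTE BLOCK (c-uniform; all signs)
    (B : ℤ → BridgePrm) (hB : ∀ σ' : ℤ, σ' = 1 ∨ σ' = -1 → BridgeOK (B σ')) (σhF : MDir → ℤ) (hσhF : ∀ du : MDir, σhF du = 1 ∨ σhF du = -1)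
    {kq : ℕ} (hκL : pr.h.natAbs ≤ kq * nL) (ℓ' R's qB Rl R'₃ qB₃ qB' qB₃' : ℕ)
    (hlay : (nL + pr.h.natAbs : ℕ) ≤ (nL : ℤ) * ℓ' + 1)
    (Rlev₁ N₁ j₀₁ j₁₁ Rlev₂ N₂ j₀₂ j₁₂ Rlev₃ N₃' j₀₃ j₁₃ : ℕ) (hRl₁ : ∀ σ' : ℤ, σ' = 1 ∨ σ' = -1 → Rlev₁ + 1 ≤ (B σ').R') (hRl₂ : Rlev₂ + 1 ≤ R's) (hRl₃ : Rlev₃ + 1 ≤ R'₃)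
    (hj₁ : j₁₁ ≤ Rlev₁) (hj₂ : j₁₂ ≤ Rlev₂) (hj₃ : j₁₃ ≤ Rlev₃)
    (hB0 : ∀ σ' : ℤ, σ' = 1 ∨ σ' = -1 → Finset.Icc (pt nL (σ' * pr.h)) (pt nL (σ' * pr.h + ℓ')) ⊆ Finset.Icc (B σ').B₀lo (B σ').B₀hi) (hRlr : Rl ≤ r)
    -- the near-`c` block READ BY THE TWO LATTICE FUNCTIONALS (L-F2): bridge regions (every frame sign), hop prism, zone box, fine extents `kA`
    {Λ₀ Λ₁ : ℤ} {kA : Fin 2 → ℤ}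
    (hΛR : ∀ σ' : ℤ, σ' = 1 ∨ σ' = -1 → ∀ x ∈ Finset.Icc (B σ').regionLo (B σ').regionHi, |pr.vβ * (σ' * x 0) - pr.vα * x 1| ≤ Λ₀ ∧ |(nL : ℤ) * x 1 - pr.h * (σ' * x 0)| ≤ Λ₁)
    (hΛQ0 : modulus nL pr.h pr.vα pr.vβ + (nL : ℤ) * ((3 * ℓ' : ℕ) : ℤ) ≤ Λ₀) (hΛQ1 : (nL : ℤ) * ((3 * ℓ' : ℕ) : ℤ) ≤ Λ₁) {Mz : ℕ}
    (hΛZ : (|pr.vβ| + |pr.vα|) * (Mz : ℤ) ≤ Λ₀ ∧ ((nL : ℤ) + |pr.h|) * (Mz : ℤ) ≤ Λ₁)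
    (hkA0 : pr.c₀ * (|pr.A| * Λ₀) ≤ kA 0 * pr.D) (hkA1 : pr.c₁ * (|pr.A| * Λ₁) ≤ kA 1 * pr.D)
    {kb : ℕ} (hkbMz : (Mz : ℤ) ≤ kb) (hπ1 : ∀ σ' : ℤ, σ' = 1 ∨ σ' = -1 → ((B σ').core1Lo 0).natAbs + ((B σ').core1Lo 1).natAbs ≤ r)
    (hclr₁ : ∀ σ' : ℤ, σ' = 1 ∨ σ' = -1 → (kb : ℤ) < (B σ').B₀lo 0 - (B σ').R' - (B σ').pr)
    {δ ηk : ℝ} (hδ : 0 < δ) (hδ1 : δ ≤ 1) (nB : ℕ)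
    -- the inner-chain fact UP TO THE LENGTH BUDGET `nF` (p3-g11 2026-08-22T02:23:54Z; the wrapper discharges it by `ChainFactF` at `n ≤ LfA K₀`)
    (hchain : ∀ (c : V) (Nr N₃ : ℕ), 0 + 1 + Nr + 1 + N₃ ≤ nB → ∀ (W : Sym2 V → unitInterval) (s : Fin (0 + 1 + Nr + 1 + N₃ + 1) → TStep (winGraph G c r))
      (T' : Fin (0 + 1 + Nr + 1 + N₃ + 1) → Finset V) (η : ℝ),
      (∀ i, (s i).L.o = (s 0).L.o) →
      (∀ i : Fin (0 + 1 + Nr + 1 + N₃), T' (Fin.castSucc i) ⊆ (s i.succ).L.X 0) →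
      (∀ i, T' i ⊆ (s i).T) →
      (∀ i, (s i).KitsAt W q Δ' δ) →
      η ≤ δ / 2 →
      (∀ i, (prodBernoulli W).real (⋃ t ∈ (s i).T \ T' i, openConn (s 0).L.o t) ≤ η) →
      1 - δ < (prodBernoulli W).real (s 0).L.reachB →
        1 - δ₂ ^ 2 < (prodBernoulli W).real (⋃ t ∈ T' (Fin.last (0 + 1 + Nr + 1 + N₃)), openConn (s 0).L.o t))
    (hcount₁ : 1 / (1 - (q : ℝ)) ^ (Δ' * N₁) ≤ δ * ((Finset.Icc j₀₁ j₁₁).card : ℝ))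
    (hcount₂ : 1 / (1 - (q : ℝ)) ^ (Δ' * N₂) ≤ δ * ((Finset.Icc j₀₂ j₁₂).card : ℝ))
    (hcount₃ : 1 / (1 - (q : ℝ)) ^ (Δ' * N₃') ≤ δ * ((Finset.Icc j₀₃ j₁₃).card : ℝ))
    (hηk : ηk ≤ δ / 2)
    (Pb Pr : ApronPrm) {Rs Kmaxb KCmaxb Kmaxr KCmaxr rsb rsr cSb cSr cU r₁ r₂ Rb : ℕ}
    (hPNb : 1 ≤ Pb.N) (hAb : Pb.A = (Mz : ℤ) + 2)
    (hd1b : Pb.W + Pb.ℓ ≤ Pb.d) (hD1b : Pb.W + Pb.ℓ + Pb.d + 2 ≤ shellD Pb) (hD2b : Pb.ℓ + Rs + Pb.d + 3 ≤ shellD Pb) (hDρb : Rs + 1 ≤ shellD Pb)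
    (hℓb : 1 ≤ Pb.ℓ) (hWb : Rs + Pb.ℓ ≤ Pb.W) (hKmaxb : shellD Pb + Pb.W ≤ Kmaxb) (hKCmaxb : shellD Pb + Mz + 1 ≤ KCmaxb)
    (hR'b : cylRadMax G φ types Pb.ℓ (Rs + KCmaxb + (Pb.W + Kmaxb)) ≤ Pb.R')
    (hwideb : ∀ σ' : ℤ, σ' = 1 ∨ σ' = -1 → ∀ j, j₀₁ ≤ j → j ≤ j₁₁ → ∀ i, ((B σ').B₀lo - (j : Site 2)) i + 2 * tanOff Pb.ℓs Pb.M ≤ ((B σ').B₀hi + (j : Site 2)) i)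
    (hdwb : ∀ σ' : ℤ, σ' = 1 ∨ σ' = -1 → ∀ j, j₀₁ ≤ j → j ≤ j₁₁ → ∀ i, ((B σ').B₀lo - (j : Site 2)) i + (Pb.d + 2 : ℕ) ≤ ((B σ').B₀hi + (j : Site 2)) i)
    (hDwb : ∀ σ' : ℤ, σ' = 1 ∨ σ' = -1 → ∀ j, j₀₁ ≤ j → j ≤ j₁₁ → ∀ i, ((B σ').B₀lo - (j : Site 2)) i + ((shellD Pb + 1 + Pb.d + KCmaxb + Rs : ℕ) : ℤ) ≤ ((B σ').B₀hi + (j : Site 2)) i)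
    (hTb : (Pb.W : ℤ) + Kmaxb + Pb.ℓ + 1 ≤ tanOff Pb.ℓs Pb.M) (hT'b : (shellD Pb : ℤ) + KCmaxb + Rs ≤ tanOff Pb.ℓs Pb.M)
    (hr₀b : Pb.N * (tanOff Pb.ℓs Pb.M + 2) + Pb.N * Pb.d + (Pb.W + Kmaxb + Pb.R') + (KCmaxb + Rs) ≤ Pb.r₀) (hRb₀ : Pb.r₀ ≤ r)
    (hrsb : 2 * (1 + Pb.N * (tanOff Pb.ℓs Pb.M + 2) + Pb.N * Pb.d + (Pb.W + Kmaxb + Pb.R') + (KCmaxb + Rs)) ≤ rsb)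
    (hcSb : (Pb.N + 1) * (tanOff Pb.ℓs Pb.M + 1) + (Pb.N + 1) * Pb.d + (2 * Pb.W + 1) * (Kmaxb + 1) * (Δg + 1) ^ Pb.R' ≤ cSb)
    (hEb : ∀ σ' : ℤ, σ' = 1 ∨ σ' = -1 → j₁₁ + (Pb.N * (tanOff Pb.ℓs Pb.M + 1) + Pb.N * Pb.d + KCmaxb) ≤ (B σ').R')
    (hreachb : r₁ + (Pb.N * (tanOff Pb.ℓs Pb.M + 1) + Pb.N * Pb.d + KCmaxb) ≤ Pb.r₀) (hr₁ : Rb ≤ r₁) (hr₁R : r₁ ≤ r)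
    (hPNr : kq + 3 ≤ Pr.N) (hAr : Pr.A = (Mz + 1 : ℕ) * (shearUnit nL pr.h : ℤ) + 1)
    (hd1r : Pr.W + Pr.ℓ ≤ Pr.d) (hD1r : Pr.W + Pr.ℓ + Pr.d + 2 ≤ shellD Pr) (hD2r : Pr.ℓ + Rs + Pr.d + 3 ≤ shellD Pr) (hDρr : Rs + 1 ≤ shellD Pr)
    (hℓr : 1 ≤ Pr.ℓ) (hWr : Rs + Pr.ℓ ≤ Pr.W) (hKmaxr : (shellD Pr + Pr.W) * (kq + 1) ≤ Kmaxr) (hKCmaxr : (shellD Pr + Mz + 1) * (kq + 1) ≤ KCmaxr)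
    (hR'r : cylRadMax G φ types Pr.ℓ (Rs + KCmaxr + (Pr.W + Kmaxr)) ≤ Pr.R')
    (hwider : ∀ Nr, ∀ k ≤ Nr, ∀ j, j₀₂ ≤ j → j ≤ j₁₂ → ∀ i, ((xRunSched nL ℓ' pr.h R's qB Nr).lo k - (j : Site 2)) i + 2 * tanOff Pr.ℓs Pr.M ≤
      ((xRunSched nL ℓ' pr.h R's qB Nr).hi k + (j : Site 2)) i)
    (hdwr : ∀ Nr, ∀ k ≤ Nr, ∀ j, j₀₂ ≤ j → j ≤ j₁₂ → ∀ i, ((xRunSched nL ℓ' pr.h R's qB Nr).lo k - (j : Site 2)) i + (Pr.d + 2 : ℕ) ≤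
      ((xRunSched nL ℓ' pr.h R's qB Nr).hi k + (j : Site 2)) i)
    (hDwr : ∀ Nr, ∀ k ≤ Nr, ∀ j, j₀₂ ≤ j → j ≤ j₁₂ → ∀ i, ((xRunSched nL ℓ' pr.h R's qB Nr).lo k - (j : Site 2)) i + ((shellD Pr + 1 + Pr.d + KCmaxr + Rs : ℕ) : ℤ) ≤
      ((xRunSched nL ℓ' pr.h R's qB Nr).hi k + (j : Site 2)) i)
    (hwidey : ∀ N₃, ∀ k ≤ N₃, ∀ j, j₀₃ ≤ j → j ≤ j₁₃ → ∀ i, ((yRunSched hnL hvL hlay R'₃ qB₃ N₃).lo k - (j : Site 2)) i + 2 * tanOff Pr.ℓs Pr.M ≤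
      ((yRunSched hnL hvL hlay R'₃ qB₃ N₃).hi k + (j : Site 2)) i)
    (hdwy : ∀ N₃, ∀ k ≤ N₃, ∀ j, j₀₃ ≤ j → j ≤ j₁₃ → ∀ i, ((yRunSched hnL hvL hlay R'₃ qB₃ N₃).lo k - (j : Site 2)) i + (Pr.d + 2 : ℕ) ≤
      ((yRunSched hnL hvL hlay R'₃ qB₃ N₃).hi k + (j : Site 2)) i)
    (hDwy : ∀ N₃, ∀ k ≤ N₃, ∀ j, j₀₃ ≤ j → j ≤ j₁₃ → ∀ i, ((yRunSched hnL hvL hlay R'₃ qB₃ N₃).lo k - (j : Site 2)) i + ((shellD Pr + 1 + Pr.d + KCmaxr + Rs : ℕ) : ℤ) ≤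
      ((yRunSched hnL hvL hlay R'₃ qB₃ N₃).hi k + (j : Site 2)) i)
    (hwiderY : ∀ Nr, ∀ k ≤ Nr, ∀ j, j₀₂ ≤ j → j ≤ j₁₂ → ∀ i, ((yRunSched hnL hvL hlay R's qB' Nr).lo k - (j : Site 2)) i + 2 * tanOff Pr.ℓs Pr.M ≤
      ((yRunSched hnL hvL hlay R's qB' Nr).hi k + (j : Site 2)) i)
    (hdwrY : ∀ Nr, ∀ k ≤ Nr, ∀ j, j₀₂ ≤ j → j ≤ j₁₂ → ∀ i, ((yRunSched hnL hvL hlay R's qB' Nr).lo k - (j : Site 2)) i + (Pr.d + 2 : ℕ) ≤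
      ((yRunSched hnL hvL hlay R's qB' Nr).hi k + (j : Site 2)) i)
    (hDwrY : ∀ Nr, ∀ k ≤ Nr, ∀ j, j₀₂ ≤ j → j ≤ j₁₂ → ∀ i, ((yRunSched hnL hvL hlay R's qB' Nr).lo k - (j : Site 2)) i + ((shellD Pr + 1 + Pr.d + KCmaxr + Rs : ℕ) : ℤ) ≤
      ((yRunSched hnL hvL hlay R's qB' Nr).hi k + (j : Site 2)) i)
    (hwideyY : ∀ N₃, ∀ k ≤ N₃, ∀ j, j₀₃ ≤ j → j ≤ j₁₃ → ∀ i, ((xRunSched nL ℓ' pr.h R'₃ qB₃' N₃).lo k - (j : Site 2)) i + 2 * tanOff Pr.ℓs Pr.M ≤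
      ((xRunSched nL ℓ' pr.h R'₃ qB₃' N₃).hi k + (j : Site 2)) i)
    (hdwyY : ∀ N₃, ∀ k ≤ N₃, ∀ j, j₀₃ ≤ j → j ≤ j₁₃ → ∀ i, ((xRunSched nL ℓ' pr.h R'₃ qB₃' N₃).lo k - (j : Site 2)) i + (Pr.d + 2 : ℕ) ≤
      ((xRunSched nL ℓ' pr.h R'₃ qB₃' N₃).hi k + (j : Site 2)) i)
    (hDwyY : ∀ N₃, ∀ k ≤ N₃, ∀ j, j₀₃ ≤ j → j ≤ j₁₃ → ∀ i, ((xRunSched nL ℓ' pr.h R'₃ qB₃' N₃).lo k - (j : Site 2)) i + ((shellD Pr + 1 + Pr.d + KCmaxr + Rs : ℕ) : ℤ) ≤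
      ((xRunSched nL ℓ' pr.h R'₃ qB₃' N₃).hi k + (j : Site 2)) i)
    (hTr : (Pr.W : ℤ) + Kmaxr + Pr.ℓ + 1 ≤ tanOff Pr.ℓs Pr.M) (hT'r : (shellD Pr : ℤ) + KCmaxr + Rs ≤ tanOff Pr.ℓs Pr.M)
    (hr₀r : Pr.N * (tanOff Pr.ℓs Pr.M + 2) + Pr.N * Pr.d + (Pr.W + Kmaxr + Pr.R') + (KCmaxr + Rs) ≤ Pr.r₀) (hRr₀ : Pr.r₀ ≤ r)
    (hrsr : 2 * (1 + Pr.N * (tanOff Pr.ℓs Pr.M + 2) + Pr.N * Pr.d + (Pr.W + Kmaxr + Pr.R') + (KCmaxr + Rs)) ≤ rsr)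
    (hcSr : (Pr.N + 1) * (tanOff Pr.ℓs Pr.M + 1) + (Pr.N + 1) * Pr.d + (2 * Pr.W + 1) * (Kmaxr + 1) * (Δg + 1) ^ Pr.R' ≤ cSr)
    (hEr : j₁₂ + (Pr.N * (tanOff Pr.ℓs Pr.M + 1) + Pr.N * Pr.d + KCmaxr) ≤ R's)
    (hEy : j₁₃ + (Pr.N * (tanOff Pr.ℓs Pr.M + 1) + Pr.N * Pr.d + KCmaxr) ≤ R'₃)
    (hreachr : r₂ + (Pr.N * (tanOff Pr.ℓs Pr.M + 1) + Pr.N * Pr.d + KCmaxr) ≤ Pr.r₀) (hr₂ : Rl ≤ r₂) (hr₂R : r₂ ≤ r)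
    (QK : ShortPcO V) (hRgRs : ∀ c', QK.RS c' ≤ Rs) (hRgcard : ∀ c', (RgO G φ QK c').card ≤ cU) (hcU1 : 1 ≤ cU)
    (hnSK : ∀ c', 22 * Mz + 58 ≤ QK.nS c') (hκSK : ∀ c', |QK.hS c'| ≤ 10 * (QK.nS c' : ℤ)) (hℓSK : ∀ c', 24 * Mz + 64 ≤ QK.ℓS c')
    (hκL10 : |pr.h| ≤ 10 * (nL : ℤ))
    (Λc : V → ℕ → Finset V) (kz : ℕ) (hkn : ∀ c', Λc c' kz ⊆ Λc c' Mz) (hΛ : ∀ c', ∀ v ∈ Λc c' Mz, v ∈ RgO G φ QK c' ∧ φ v - φ c' ∈ box 2 Mz)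
    (hZ : ∀ c', (↑(Λc c' Mz) : Set V) ⊆ cyl φ c' Mz) (hMz : Mz < nL) (hclrz : (Mz + 4) * (nL + pr.h.natAbs) ≤ nL * (ℓ' + 1))
    (hcz : ∀ c, c ∈ Λc c kz) (hzconn : ∀ c, ∀ s ∈ Λc c kz, PathIn G (↑(Λc c kz) : Set V) c s) (hRsr : Rs ≤ r)
    {ρZ : ℕ} (hZρ : ∀ c', ∀ s ∈ Λc c' kz, s ∈ graphBall G c' ρZ) (hρr : ρZ ≤ r)
    (hZU : ∀ c, Λc c kz ⊆ pgramPrismFin G φ c nL pr.h (3 * ℓ') Rl)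
    (Qb Fb : ℤ → V → Finset V)
    (hQb : ∀ σ' : ℤ, σ' = 1 ∨ σ' = -1 → ∀ c c', ∀ w ∈ Qb σ' c', w ∈ graphBall G c' Rb ∧
      rootFrame φ c σ' w ∈ Finset.Icc (rootFrame φ c σ' c' - (((B σ').pr : ℕ) : Site 2)) (rootFrame φ c σ' c' + (((B σ').pr : ℕ) : Site 2)))
    (hFb : ∀ σ' : ℤ, σ' = 1 ∨ σ' = -1 → ∀ c c', ∀ w ∈ Fb σ' c', w ∈ Qb σ' c' ∧
      rootFrame φ c σ' w ∈ Finset.Icc (rootFrame φ c σ' c' + (B σ').dlo) (rootFrame φ c σ' c' + (B σ').dhi))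
    (hFZ : ∀ σ' : ℤ, σ' = 1 ∨ σ' = -1 → ∀ c', Disjoint (Fb σ' c') (Λc c' Mz))
    (kk₁ kk₂ kk₃ : ℕ) (hkN₁ : kk₁ * (Δg + 1) ^ (2 * rsb) ≤ N₁) (hkN₂ : kk₂ * (Δg + 1) ^ (2 * rsr) ≤ N₂) (hkN₃ : kk₃ * (Δg + 1) ^ (2 * rsr) ≤ N₃')
    (hk₁ : (1 - (q : ℝ) ^ (1 + Δg * cSb + cSb * cU)) ^ kk₁ ≤ δ) (hk₂ : (1 - (q : ℝ) ^ (1 + Δg * cSr + cSr * cU)) ^ kk₂ ≤ δ)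
    (hk₃ : (1 - (q : ℝ) ^ (1 + Δg * cSr + cSr * cU)) ^ kk₃ ≤ δ)
    (hzone : ∀ c', 1 - δ ^ 2 < (bondPercolation G q).real (UniqZone.zone G (Λc c') kz Mz))
    (hexitb : ∀ σ' : ℤ, σ' = 1 ∨ σ' = -1 → ∀ c' (i : Fin 2) (σ₀ : ℤˣ), 1 - δ ^ 2 < (bondPercolation G q).real
      (linkIn (↑(RgO G φ QK c') : Set V) (Λc c' kz) (pexRO G φ QK Mz Pb.A σ' i σ₀ c')))
    (hexitr : ∀ σ' : ℤ, σ' = 1 ∨ σ' = -1 → ∀ c' (i : Fin 2) (σ₀ : ℤˣ), 1 - δ ^ 2 < (bondPercolation G q).real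
      (linkIn (↑(RgO G φ QK c') : Set V) (Λc c' kz) (pexXO G φ QK Mz nL pr.h Pr.A σ' i σ₀ c')))
    (hexity : ∀ σT : ℤ, σT = 1 ∨ σT = -1 → ∀ c' (i : Fin 2) (σ₀ : ℤˣ), 1 - δ ^ 2 < (bondPercolation G q).real
      (linkIn (↑(RgO G φ QK c') : Set V) (Λc c' kz) (pexYO G φ QK Mz nL pr.h Pr.A σT i σ₀ c')))
    (hbridge : ∀ σ' : ℤ, σ' = 1 ∨ σ' = -1 → ∀ c', 1 - δ ^ 2 < (bondPercolation G q).real (linkIn (↑(Qb σ' c') : Set V) (Λc c' kz) (Fb σ' c')))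
    (hlongx : ∀ σ' : ℤ, σ' = 1 ∨ σ' = -1 → ∀ c' (τ : ℤ), τ = 1 ∨ τ = -1 → 1 - δ ^ 2 < (bondPercolation G q).real
      (linkIn (pgramPrism G φ c' nL pr.h (3 * ℓ') Rl) (Λc c' kz) (pgSideHalfW G φ c' nL pr.h ℓ' Rl σ' (σ' * τ))))
    (hlongy : ∀ σT : ℤ, σT = 1 ∨ σT = -1 → ∀ c' (τ : ℤ), τ = 1 ∨ τ = -1 → 1 - δ ^ 2 < (bondPercolation G q).real
      (linkIn (pgramPrism G φ c' nL pr.h (3 * ℓ') Rl) (Λc c' kz) (pgTopPieceW G φ c' nL pr.h ℓ' Rl σT τ pr.vα)))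
    {R₁k : ℕ}
    (hR₁k : ∀ (c' : V) (R' : ℕ), R₁k ≤ R' → ∀ (Rw : ℕ) (D' B' : Finset V), (∀ d ∈ D', d ∈ graphBall G c' Rw) →
      (∀ d ∈ D', ∀ d' ∈ D', φ d - φ d' ∈ box 2 m) → B' ⊆ D' → (∀ a ∈ B', a ∈ graphBall G c' ρZ) →
        (bondPercolation G q).real (excess G c' R' D' B') ≤ ηk)
    (hR₁b : R₁k ≤ r - Pb.r₀) (hR₁r : R₁k ≤ r - Pr.r₀)
    -- the FACE KIT: constants, exit table rooms, reach, inputs at accuracy `δ₂`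
    (PA : ApronPrm) {Kmax KCmax rs cS : ℕ} (hPN : 3 ≤ PA.N) (hA : PA.A = (Mz + 1 : ℕ) * pr.D + 1)
    (hd1 : PA.W + PA.ℓ ≤ PA.d) (hD1 : PA.W + PA.ℓ + PA.d + 2 ≤ shellD PA) (hD2 : PA.ℓ + Rs + PA.d + 3 ≤ shellD PA) (hDρ : Rs + 1 ≤ shellD PA)
    (hℓ : 1 ≤ PA.ℓ) (hW : Rs + PA.ℓ ≤ PA.W) (hKmax : (shellD PA + PA.W) * 3 ≤ Kmax) (hKCmax : (shellD PA + Mz + 1) * 3 ≤ KCmax)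
    (hR' : cylRadMax G φ types PA.ℓ (Rs + KCmax + (PA.W + Kmax)) ≤ PA.R')
    (hMtan : tanOff PA.ℓs PA.M ≤ (M : ℤ) + 1) (hMd : PA.d + 2 ≤ 2 * M + 2) (hMD : shellD PA + 1 + PA.d + KCmax + Rs ≤ 2 * M + 2)
    (hT : (PA.W : ℤ) + Kmax + PA.ℓ + 1 ≤ tanOff PA.ℓs PA.M) (hT' : (shellD PA : ℤ) + KCmax + Rs ≤ tanOff PA.ℓs PA.M)
    (hr₀ : PA.N * (tanOff PA.ℓs PA.M + 2) + PA.N * PA.d + (PA.W + Kmax + PA.R') + (KCmax + Rs) ≤ PA.r₀) (hr₀L : PA.r₀ + 1 ≤ 2 * L')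
    (hrs : 2 * (1 + PA.N * (tanOff PA.ℓs PA.M + 2) + PA.N * PA.d + (PA.W + Kmax + PA.R') + (KCmax + Rs)) ≤ rs)
    (hcS : (PA.N + 1) * (tanOff PA.ℓs PA.M + 1) + (PA.N + 1) * PA.d + (2 * PA.W + 1) * (Kmax + 1) * (Δg + 1) ^ PA.R' ≤ cS)
    (hE : Rlev + (PA.N * (tanOff PA.ℓs PA.M + 1) + PA.N * PA.d + KCmax) ≤ E)
    (hreach : r + (PA.N * (tanOff PA.ℓs PA.M + 1) + PA.N * PA.d + KCmax) ≤ PA.r₀)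
    {C MK : ℕ} (hn1 : ∀ c', 1 ≤ QK.nS c') (hEq : ∀ c', ((MK : ℤ) + 1) * (QK.nS c' + |QK.hS c'|) ≤ (QK.nS c' : ℤ) * (QK.ℓS c' + 1))
    (hM4 : 4 * C + 1 ≤ MK) (hn2 : ∀ c', 2 * C ≤ QK.nS c') {kL : Fin 2 → ℤ} (hexitR : PA.A + 2 * pr.D ≤ (C : ℤ) * pr.D)
    (hexitL : ∀ I, PA.A + pr.climC I (pr.bOf I) I + pr.D ≤ kL I * pr.D) (hkC : ∀ I, (kL I + 1) * pr.D ≤ (C : ℤ) * (pr.cOf I * pr.L I))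
    (kk : ℕ) (hN : kk * (Δg + 1) ^ (2 * rs) ≤ N) (hk : (1 - (q : ℝ) ^ (1 + Δg * cS + cS * cU)) ^ kk ≤ δ₂)
    (hzoneK : ∀ c', 1 - δ₂ ^ 2 < (bondPercolation G q).real (UniqZone.zone G (Λc c') kz Mz))
    (hexitK : ∀ (I : Fin 2) c' (i : Fin 2) (σ₀ : ℤˣ), 1 - δ₂ ^ 2 < (bondPercolation G q).real
      (linkIn (↑(RgO G φ QK c') : Set V) (Λc c' kz) (pr.pexFO G φ I (pr.bOf I) QK C i σ₀ c')))
    -- THE PER-CENTRE NUMBERS (x-faces `du.1 = 0`, y′-faces `du.1 = 1`)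
    (numsX : ∀ (a' : ℕ) (x : Site 2) (du : MDir) (j : ℕ) (pc : ℤ) (c' : V), du.1 = 0 → j < P.K → ∀ yF : V,
      pr.ψ φ w₀ yF = P.faceCen x du j → pc = relφ φ w₀ yF (pr.bOf du.1) →
      pr.frame φ w₀ du.1 (pr.bOf du.1) c' ∈ Finset.Icc (loN P x du j pc (aw du) - ((E : ℕ) : Site 2)) (hiN P x du j pc (aw du) + ((E : ℕ) : Site 2)) →
      c' ∈ graphBall G w₀ ((concRadii2N P gap gap' E₀ L' off).rE a' x du - r) →
      L' ≤ (concRadii2N P gap gap' E₀ L' off).rM a' (x + stepVec du) → r ≤ (concRadii2N P gap gap' E₀ L' off).rE a' x du →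
      FaceRunNumsX4 G φ (pr.ψ φ w₀) c' pr.A nL pr.h pr.vα pr.vβ pr.c₀ pr.c₁ pr.D du (sgOf du) (B (sgOf du)) ℓ' R's qB R'₃ qB₃ pr.vα hnL hvL hlay Mz
        (P.farCore x du j k₀) (targetMM G φ pr P w₀ (concRadii2N P gap gap' E₀ L' off) b₀ a' x du L') (Λc c' Mz) r (kA du.1) (kA (oth du.1)))
    (numsY : ∀ (a' : ℕ) (x : Site 2) (du : MDir) (j : ℕ) (pc : ℤ) (c' : V), du.1 = 1 → j < P.K → ∀ yF : V,
      pr.ψ φ w₀ yF = P.faceCen x du j → pc = relφ φ w₀ yF (pr.bOf du.1) →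
      pr.frame φ w₀ du.1 (pr.bOf du.1) c' ∈ Finset.Icc (loN P x du j pc (aw du) - ((E : ℕ) : Site 2)) (hiN P x du j pc (aw du) + ((E : ℕ) : Site 2)) →
      c' ∈ graphBall G w₀ ((concRadii2N P gap gap' E₀ L' off).rE a' x du - r) →
      L' ≤ (concRadii2N P gap gap' E₀ L' off).rM a' (x + stepVec du) → r ≤ (concRadii2N P gap gap' E₀ L' off).rE a' x du →
      FaceRunNumsY4 G φ (pr.ψ φ w₀) c' pr.A nL pr.h pr.vα pr.vβ pr.c₀ pr.c₁ pr.D du (σhF du) (sgOf du) (B (σhF du)) ℓ' R's qB' R'₃ qB₃' pr.vα hnL hvL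
        hlay Mz (P.farCore x du j k₀) (targetMM G φ pr P w₀ (concRadii2N P gap gap' E₀ L' off) b₀ a' x du L') (Λc c' Mz) r (kA du.1) (kA (oth du.1)))
    -- the providers' stride counts within the budget
    (hnFx : ∀ (a' : ℕ) (x : Site 2) (du : MDir) (j : ℕ) (pc : ℤ) (c' : V) (hI : du.1 = 0) (hj : j < P.K) (yF : V)
      (hyF : pr.ψ φ w₀ yF = P.faceCen x du j) (hpc : pc = relφ φ w₀ yF (pr.bOf du.1))
      (h1 : pr.frame φ w₀ du.1 (pr.bOf du.1) c' ∈ Finset.Icc (loN P x du j pc (aw du) - ((E : ℕ) : Site 2)) (hiN P x du j pc (aw du) + ((E : ℕ) : Site 2)))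
      (h2 : c' ∈ graphBall G w₀ ((concRadii2N P gap gap' E₀ L' off).rE a' x du - r))
      (hM : L' ≤ (concRadii2N P gap gap' E₀ L' off).rM a' (x + stepVec du)) (hE : r ≤ (concRadii2N P gap gap' E₀ L' off).rE a' x du),
      0 + 1 + (numsX a' x du j pc c' hI hj yF hyF hpc h1 h2 hM hE).Nr + 1 + (numsX a' x du j pc c' hI hj yF hyF hpc h1 h2 hM hE).N₃ ≤ nB)
    (hnFy : ∀ (a' : ℕ) (x : Site 2) (du : MDir) (j : ℕ) (pc : ℤ) (c' : V) (hI : du.1 = 1) (hj : j < P.K) (yF : V)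
      (hyF : pr.ψ φ w₀ yF = P.faceCen x du j) (hpc : pc = relφ φ w₀ yF (pr.bOf du.1))
      (h1 : pr.frame φ w₀ du.1 (pr.bOf du.1) c' ∈ Finset.Icc (loN P x du j pc (aw du) - ((E : ℕ) : Site 2)) (hiN P x du j pc (aw du) + ((E : ℕ) : Site 2)))
      (h2 : c' ∈ graphBall G w₀ ((concRadii2N P gap gap' E₀ L' off).rE a' x du - r))
      (hM : L' ≤ (concRadii2N P gap gap' E₀ L' off).rM a' (x + stepVec du)) (hE : r ≤ (concRadii2N P gap gap' E₀ L' off).rE a' x du),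
      0 + 1 + (numsY a' x du j pc c' hI hj yF hyF hpc h1 h2 hM hE).Nr + 1 + (numsY a' x du j pc c' hI hj yF hyF hpc h1 h2 hM hE).N₃ ≤ nB) :
    FaceOblRM G (⟨cellGeomSG₂b G (pr.ψ φ w₀) P w₀ (concRadii2N P gap gap' E₀ L' off) b₀, q, δc⟩ : KSchA V ℕ)
      (faceDataSG G (pr.ψ φ w₀) P w₀ (concRadii2N P gap gap' E₀ L' off)) Δ' δ₂ :=
  faceOblRM_fineNb2 (pr := pr) (φ := φ) (P := P) (w₀ := w₀) (gap := gap) (gap' := gap') (E₀ := E₀) (L' := L') (off := off)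
    (b₀ := b₀) (q := q) (δc := δc) hlip hstep hb₀ hb1 hc₀ hc₁ hDd hD hL0 hL1 hgap hgap20 hgapc hE₀ hL' hoff hoffN hRlev hRlev' hk₀ hk₀' hroomF hkF
    haw hcount hη R₁ hR₁ hdiam hgapR
    (hkits_faceSteps_of_nums9 hlip hstep hfr hκ hΔg pr w₀ P gap gap' E₀ L' off b₀ q δc hb₀ hc₀ hc₁ hDd hD hL0 hL1 hA0 hnL hvL hmf hgap hE₀ hL'
      hgapR aw Rlev N M hk₀ hk₀' hRlev hRlev' hroomF hkF hnC hU3 hδ₂ B hB σhF hσhF hκL ℓ' R's qB Rl R'₃ qB₃ qB' qB₃' hlay Rlev₁ N₁ j₀₁ j₁₁ Rlev₂ N₂ j₀₂ j₁₂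
      Rlev₃ N₃' j₀₃ j₁₃ hRl₁ hRl₂ hRl₃ hj₁ hj₂ hj₃ hB0 hRlr hΛR hΛQ0 hΛQ1 hΛZ hkA0 hkA1 hkbMz hπ1 hclr₁ hδ hδ1 nB hchain hcount₁ hcount₂ hcount₃
      hηk Pb Pr hPNb hAb hd1b hD1b hD2b hDρb hℓb hWb hKmaxb hKCmaxb hR'b hwideb hdwb hDwb hTb hT'b hr₀b hRb₀ hrsb hcSb hEb hreachb hr₁ hr₁R hPNr
      hAr hd1r hD1r hD2r hDρr hℓr hWr hKmaxr hKCmaxr hR'r hwider hdwr hDwr hwidey hdwy hDwy hwiderY hdwrY hDwrY hwideyY hdwyY hDwyY hTr hT'r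
      hr₀r hRr₀ hrsr hcSr hEr hEy hreachr hr₂ hr₂R QK hRgRs hRgcard hcU1 hnSK hκSK hℓSK hκL10 Λc kz hkn hΛ hZ hMz hclrz hcz hzconn hRsr hZρ hρr hZU Qb Fb
      hQb hFb hFZ kk₁ kk₂ kk₃ hkN₁ hkN₂ hkN₃ hk₁ hk₂ hk₃ hzone hexitb hexitr hexity hbridge hlongx hlongy hdiam hR₁k hR₁b hR₁r PA hPN hA hd1 hD1 hD2 hDρ
      hℓ hW hKmax hKCmax hR' hMtan hMd hMD hT hT' hr₀ hr₀L hrs hcS hE hreach hn1 hEq hM4 hn2 hexitR hexitL hkC kk hN hk hzoneK hexitK numsX numsY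
      hnFx hnFy)

end Skelφ

end Summit.CriticalPhenomena.PercolationContinuityZ3.Theorems.Transplant

end
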